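import Summits.ResolutionOfSingularities.ResolutionOfSingularities.Theorems.EquisingularLiftEquisingularLiftNatTowerRationalDefs
import Summits.ResolutionOfSingularities.ResolutionOfSingularities.Theorems.EquisingularLiftEquisingularLiftNatDirectionCentreSection
import Summits.ResolutionOfSingularities.ResolutionOfSingularities.Theorems.EquisingularLiftEquisingularLiftNatConeRoundCentre
import Literature.AlgebraicGeometry.Morphisms.CechH1Projective
import HarnessLib

/-!
# [OURS · L1 W4.5(b) · EL♮(3)] TOWER₃ / NOSE-TOWER₃ input (d)/(R4) `hCrat` — TRANSPORT OF THE RATIONAL ROOT `V(𝒞) ≅ ℙ¹_O` ALONG THE ROUNDS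

Crux chain w45b (cell `res-hironaka`, slot W4.5(b)), working crux **EL♮** = stmt-ResolutionOfSingularities-20038, child **EL♮(3)** =
stmt-ResolutionOfSingularities-20148, route EquisingularLift, line `sections`; rungs TOWER₃ / NOSE-TOWER₃ (registered stubs
`stub_elnat_coneTowerPointResolution`, `stub_elnat_ratNoseTowerResolution_of_subchainLift₃`). Written by res-L1-type-o6 g30 on res-plan-2's
IDLE POOL DEAL #69 (1) / res-L1-w45b-plan-1 NO OBJECTION 2026-08-27T20:11:54Z («o6 → TOWER₃ input (d)/(R4) `hCrat`»).
HONEST FRAMING: «[OURS · L1 W4.5b] replaces the role of nothing printed; NOT a statement of the manuscript»; pure category-theoretic glue over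
the chain's own vocabulary; AI-written, gate-checked, weaker than expert review. No `sorry`; standard axioms; DEF-FREE.
`--supports stmt-ResolutionOfSingularities-20148 --as helper`.

THE INPUT (d), verbatim as both roots of res-L1-w45b-stub-2's `…NatTowerRuledRoots` (p562947, `DirLift.ruled_curveStep_root` /
`DirLift.ruled_round_root`) consume it:

    (hCrat : RationalCarrier (redSub F₉ Z₉ hZ₉) →
      ∃ e₁ : 𝒞.subscheme ≅ ProjCech.PP O 1, e₁.hom ≫ ProjCech.toSpec O 1 = 𝒞.subschemeι ≫ σ ≫ q)

— «if the reduced carrier curve `Z̃₉` downstairs is a projective line, the root centre `V(𝒞)` upstairs IS `ℙ¹_O` over `Spec O`».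

WHAT THIS FILE SETTLES.  At every ROUND root the centre is ISOMORPHIC OVER THE PREVIOUS STAGE to the previous centre — for a Čech/direction
round `𝒞 = controlledTransform τ₀ I 𝒟 1` by T-DIRLIFT D3b `exists_subschemeIso_directionCentre` (p555056: `e' : V(𝒞) ≅ V(I)` with
`e'.hom ≫ I.subschemeι = 𝒞.subschemeι ≫ τ₀`), for a cone round by res-D-pv-051's centre-isomorphism chain (p547344) — and res-D-pv-051's
T-DIRLIFT-UP `exists_directionLift_of_unobstructed` (sig of record 9b7825e935ffb8f7) takes the rational root (R4) of `I` as an INPUT without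
re-issuing it for the new centre.  Hence (d) at a round root is (d) at the previous root TRANSPORTED along that isomorphism:
* `RatCarrier.exists_isoPP_of_iso` — an `O`-isomorphism `C ≅ ℙ¹_O` transports along any isomorphism `C' ≅ C` over `Spec O`;
* `RatCarrier.exists_isoPP_subscheme_of_iso_over` — the same for closed subschemes `V(I) ⊆ X`, `V(I₀) ⊆ X₀` and an iso over `τ : X ⟶ X₀`;
* `RatCarrier.hCrat_of_iso_over` — the `hCrat`-shaped implication for `I` from the one for `I₀` (any downstairs certificate `C₉`);
* `RatCarrier.hCrat_directionCentre` (+ `_of_isLocallyNoetherian`) — the Čech/direction round: (d) for `controlledTransform τ₀ I 𝒟 1` from (d)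
  for `I`, under exactly D3b's hypotheses (`IsBlowup τ₀ I`, `I * I ≤ 𝒟`, quasi-regular direction frames along `supp I`);
* `RatCarrier.hCrat_coneRound` (rev 2) — the CONE round: (d) for the new cut `V((𝓔 ⊔ 𝒦)·𝒪_{X} ⊔ St 𝒦)` from (d) for the old centre
  `V(𝓔 ⊔ 𝒦)`, under exactly the hypotheses of res-D-pv-051's `coneRound_centreIso` (p547344: `IsEffectiveCartier (𝓔|_{V(𝒦)})`, `IsBlowup τ (𝓔 ⊔ 𝒦)`);
* `RatCarrier.hCrat_reassoc` — the right-hand side rebracketed `((τ ≫ σ) ≫ q` form) as the round root of p562947 spells the new stage map;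
* `RatCarrier.rationalCarrier_of_iso`, `RatCarrier.rationalCarrier_PP` — sanity: the downstairs certificate is isomorphism-invariant and
  `ℙ¹_{k'}` carries it.
WHAT IT DOES NOT SETTLE (honest): (d) at the CURVE-STEP BIRTH (`𝒞 = 𝓢 ⊔ K` of res-D-pv-029's `Tower.inv₂_of_invKC_curveStep`), i.e.
«a proper `O`-flat regular `O`-curve with special fibre `≅ ℙ¹_k` is `≅ ℙ¹_O`» — the one genuinely new debt of the rational tower
(res-L1-w45b-stub-2's docstring in p562947); it is carried there as the named hypothesis until a constructor or a proof lands.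

References (index only): p562947 (roots), p555056 (D3b), p547344 (cone-round centre isos), …NatTowerRationalDefs (`RationalCarrier`),
Literature `Morphisms/CechH1Projective` (`ProjCech.PP`, `ProjCech.toSpec`).
-/

set_option linter.dupNamespace false -- mandated namespace `Summit.<Summit>.<Problem>` of this single-conjunct summit

noncomputable section

open CategoryTheory AlgebraicGeometry TopologicalSpace
open Literature.AlgebraicGeometry.Resolution
open Literature.AlgebraicGeometry.Morphisms (ProjCech.PP ProjCech.toSpec)
open AlgebraicGeometry.Scheme.IdealSheafData

namespace Summit.ResolutionOfSingularities.ResolutionOfSingularities.Cruxes.EquisingularLiftNat.Sections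

namespace RatCarrier

variable {O : Type} [CommRing O]

/-! ## Transport of an `O`-isomorphism with `ℙ¹_O` along an isomorphism over `Spec O` -/

/-- An `O`-isomorphism `C ≅ ℙ¹_O` transports along any isomorphism `e' : C' ≅ C` compatible with the structure maps to `Spec O`.
[OURS · pure category theory] toward `stub_elnat_coneTowerPointResolution` / `stub_elnat_ratNoseTowerResolution_of_subchainLift₃`; NOT a
statement of the manuscript. -/
theorem exists_isoPP_of_iso {C C' : Scheme.{0}} (g : C ⟶ Spec (.of O)) (g' : C' ⟶ Spec (.of O))
    (e' : C' ≅ C) (he' : e'.hom ≫ g = g')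
    (e : C ≅ ProjCech.PP O 1) (he : e.hom ≫ ProjCech.toSpec O 1 = g) :
    ∃ e₁ : C' ≅ ProjCech.PP O 1, e₁.hom ≫ ProjCech.toSpec O 1 = g' :=
  ⟨e' ≪≫ e, by rw [Iso.trans_hom, Category.assoc, he, he']⟩

/-- The same for closed subschemes: `V(I) ⊆ X` isomorphic over `τ : X ⟶ X₀` to `V(I₀) ⊆ X₀`, and `V(I₀) ≅ ℙ¹_O` over `X₀ ⟶ Spec O`,
give `V(I) ≅ ℙ¹_O` over `X ⟶ X₀ ⟶ Spec O`. [OURS · pure category theory]; NOT a statement of the manuscript. -/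
theorem exists_isoPP_subscheme_of_iso_over {X₀ X : Scheme.{0}} (f₀ : X₀ ⟶ Spec (.of O)) (τ : X ⟶ X₀)
    (I₀ : X₀.IdealSheafData) (I : X.IdealSheafData)
    (e' : I.subscheme ≅ I₀.subscheme) (he' : e'.hom ≫ I₀.subschemeι = I.subschemeι ≫ τ)
    (e : I₀.subscheme ≅ ProjCech.PP O 1) (he : e.hom ≫ ProjCech.toSpec O 1 = I₀.subschemeι ≫ f₀) :
    ∃ e₁ : I.subscheme ≅ ProjCech.PP O 1, e₁.hom ≫ ProjCech.toSpec O 1 = I.subschemeι ≫ τ ≫ f₀ :=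
  exists_isoPP_of_iso (I₀.subschemeι ≫ f₀) (I.subschemeι ≫ τ ≫ f₀) e' (by rw [← Category.assoc, he', Category.assoc]) e he

/-! ## The `hCrat`-shaped implication transports -/

/-- **(d) TRANSPORTS ALONG THE ROUNDS.**  If the previous root centre `V(I₀) ⊆ X₀` satisfies (d) — `RationalCarrier C₉ → V(I₀) ≅ ℙ¹_O` over
`Spec O` — and the new centre `V(I) ⊆ X` is isomorphic to `V(I₀)` over `τ : X ⟶ X₀`, then `V(I)` satisfies (d) over `X ⟶ X₀ ⟶ Spec O`, for the
SAME downstairs certificate `C₉` (the carrier `Z̃₉` of the tower is fixed across its rounds). [OURS · pure logic] toward the TOWER₃ / NOSE-TOWER₃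
stubs; NOT a statement of the manuscript. -/
theorem hCrat_of_iso_over {X₀ X : Scheme.{0}} (f₀ : X₀ ⟶ Spec (.of O)) (τ : X ⟶ X₀)
    (I₀ : X₀.IdealSheafData) (I : X.IdealSheafData)
    (e' : I.subscheme ≅ I₀.subscheme) (he' : e'.hom ≫ I₀.subschemeι = I.subschemeι ≫ τ) {C₉ : Scheme.{0}}
    (hCrat₀ : RationalCarrier C₉ → ∃ e : I₀.subscheme ≅ ProjCech.PP O 1, e.hom ≫ ProjCech.toSpec O 1 = I₀.subschemeι ≫ f₀) :
    RationalCarrier C₉ → ∃ e₁ : I.subscheme ≅ ProjCech.PP O 1, e₁.hom ≫ ProjCech.toSpec O 1 = I.subschemeι ≫ τ ≫ f₀ :=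
  fun h => by
    obtain ⟨e, he⟩ := hCrat₀ h
    exact exists_isoPP_subscheme_of_iso_over f₀ τ I₀ I e' he' e he

/-- Rebracketing: the round root of p562947 spells the new stage map as `(τ ≫ σ) ≫ q`; this is the same statement. [OURS · pure logic];
NOT a statement of the manuscript. -/
theorem hCrat_reassoc {X₀ X P : Scheme.{0}} (σ : X₀ ⟶ P) (q : P ⟶ Spec (.of O)) (τ : X ⟶ X₀) (I : X.IdealSheafData) {C₉ : Scheme.{0}}
    (h : RationalCarrier C₉ → ∃ e₁ : I.subscheme ≅ ProjCech.PP O 1, e₁.hom ≫ ProjCech.toSpec O 1 = I.subschemeι ≫ τ ≫ σ ≫ q) :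
    RationalCarrier C₉ → ∃ e₁ : I.subscheme ≅ ProjCech.PP O 1, e₁.hom ≫ ProjCech.toSpec O 1 = I.subschemeι ≫ (τ ≫ σ) ≫ q :=
  fun hr => by
    obtain ⟨e₁, he₁⟩ := h hr
    exact ⟨e₁, by rw [he₁, Category.assoc]⟩

/-! ## The Čech / direction round: the direction centre inherits (d) from its root -/

/-- **(d) FOR THE DIRECTION CENTRE.**  For a blow-up `τ : X ⟶ X₀` of the in-carrier curve `V(I)` (universally closed) and a direction `𝒟`
along `I` (`I·I ≤ 𝒟`, quasi-regular 2-frames `c` with `𝒟_x = (c₀) + (c₁²)` at the points of `supp I`), the direction centre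
`controlledTransform τ I 𝒟 1` satisfies (d) over `X ⟶ X₀ ⟶ Spec O` as soon as `V(I)` does over `X₀ ⟶ Spec O` — by T-DIRLIFT D3b
`exists_subschemeIso_directionCentre` (res-L1-w45b-stub-2, p555056) and transport. [OURS · one-line composition] toward the TOWER₃ /
NOSE-TOWER₃ stubs (the `hCrat` input of `DirLift.ruled_round_root` at a Čech round); NOT a statement of the manuscript. -/
theorem hCrat_directionCentre {X₀ X : Scheme.{0}} (f₀ : X₀ ⟶ Spec (.of O)) (τ : X ⟶ X₀) (I : X₀.IdealSheafData)
    (hτ : IsBlowup τ I) [UniversallyClosed τ] (𝒟 : X₀.IdealSheafData) (hI𝒟 : I * I ≤ 𝒟)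
    (hdir : ∀ x ∈ I.support, ∃ c : Fin 2 → X₀.presheaf.stalk x, Ideal.span (Set.range c) = stalkIdeal I x ∧
      IsQuasiRegular c ∧ stalkIdeal 𝒟 x = Ideal.span {c 0} ⊔ Ideal.span {c 1 * c 1}) {C₉ : Scheme.{0}}
    (hCrat₀ : RationalCarrier C₉ → ∃ e : I.subscheme ≅ ProjCech.PP O 1, e.hom ≫ ProjCech.toSpec O 1 = I.subschemeι ≫ f₀) :
    RationalCarrier C₉ → ∃ e₁ : (controlledTransform τ I 𝒟 1).subscheme ≅ ProjCech.PP O 1,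
      e₁.hom ≫ ProjCech.toSpec O 1 = (controlledTransform τ I 𝒟 1).subschemeι ≫ τ ≫ f₀ := by
  obtain ⟨e', he'⟩ := exists_subschemeIso_directionCentre hτ 𝒟 hI𝒟 hdir
  exact hCrat_of_iso_over f₀ τ I _ e' he' hCrat₀

/-- The same with `τ` proper from `X₀` locally Noetherian (`IsBlowup.isProper`), as `directionRoundStep` carries it. [OURS · one-line
composition]; NOT a statement of the manuscript. -/
theorem hCrat_directionCentre_of_isLocallyNoetherian {X₀ X : Scheme.{0}} [IsLocallyNoetherian X₀] (f₀ : X₀ ⟶ Spec (.of O))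
    (τ : X ⟶ X₀) (I : X₀.IdealSheafData) (hτ : IsBlowup τ I) (𝒟 : X₀.IdealSheafData) (hI𝒟 : I * I ≤ 𝒟)
    (hdir : ∀ x ∈ I.support, ∃ c : Fin 2 → X₀.presheaf.stalk x, Ideal.span (Set.range c) = stalkIdeal I x ∧
      IsQuasiRegular c ∧ stalkIdeal 𝒟 x = Ideal.span {c 0} ⊔ Ideal.span {c 1 * c 1}) {C₉ : Scheme.{0}}
    (hCrat₀ : RationalCarrier C₉ → ∃ e : I.subscheme ≅ ProjCech.PP O 1, e.hom ≫ ProjCech.toSpec O 1 = I.subschemeι ≫ f₀) :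
    RationalCarrier C₉ → ∃ e₁ : (controlledTransform τ I 𝒟 1).subscheme ≅ ProjCech.PP O 1,
      e₁.hom ≫ ProjCech.toSpec O 1 = (controlledTransform τ I 𝒟 1).subschemeι ≫ τ ≫ f₀ := by
  obtain ⟨e', he'⟩ := exists_subschemeIso_directionCentre_of_isLocallyNoetherian hτ 𝒟 hI𝒟 hdir
  exact hCrat_of_iso_over f₀ τ I _ e' he' hCrat₀

/-! ## Sanity: the downstairs certificate -/

/-- `RationalCarrier` is invariant under isomorphism of the carrier. [OURS · pure logic]; NOT a statement of the manuscript. -/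
theorem rationalCarrier_of_iso {C C' : Scheme.{0}} (e : C' ≅ C) (h : RationalCarrier C) : RationalCarrier C' := by
  obtain ⟨k', _, ⟨e₀⟩⟩ := h
  exact ⟨k', inferInstance, ⟨e ≪≫ e₀⟩⟩

/-- `ℙ¹_{k'}` (in the `ProjCech.PP` spelling of the upstairs currency) is a rational carrier: the two spellings of the projective line over a
field agree definitionally. [OURS · sanity anchor]; NOT a statement of the manuscript. -/
theorem rationalCarrier_PP (k' : Type) [Field k'] : RationalCarrier (ProjCech.PP k' 1) :=
  ⟨k', inferInstance, ⟨Iso.refl _⟩⟩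

/-! ## The cone round: the new cut inherits (d) from the old centre (rev 2, appended) -/

/-- **(d) FOR THE CONE ROUND.**  With `C := 𝓔 ⊔ 𝒦` on a locally Noetherian stage `X₀`, `τ : X ⟶ X₀` the blow-up of `C`, and the carrier
cutting an effective Cartier divisor on the cone (`IsEffectiveCartier (𝓔|_{V(𝒦)})`), the new cut `V(C·𝒪_X ⊔ St_C 𝒦)` satisfies (d) over
`X ⟶ X₀ ⟶ Spec O` as soon as `V(C)` does over `X₀ ⟶ Spec O` — by res-D-pv-051's `coneRound_centreIso` (p547344) and transport.
[OURS · one-line composition] toward the TOWER₃ / NOSE-TOWER₃ stubs (the `hCrat` input of `DirLift.ruled_round_root` at a cone round); NOT a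
statement of the manuscript. -/
theorem hCrat_coneRound {X₀ X : Scheme.{0}} [IsLocallyNoetherian X₀] (f₀ : X₀ ⟶ Spec (.of O)) (𝓔 𝒦 : X₀.IdealSheafData) {τ : X ⟶ X₀}
    (hE𝒦 : IsEffectiveCartier (𝓔.comap 𝒦.subschemeι)) (hτ : IsBlowup τ (𝓔 ⊔ 𝒦)) {C₉ : Scheme.{0}}
    (hCrat₀ : RationalCarrier C₉ →
      ∃ e : (𝓔 ⊔ 𝒦).subscheme ≅ ProjCech.PP O 1, e.hom ≫ ProjCech.toSpec O 1 = (𝓔 ⊔ 𝒦).subschemeι ≫ f₀) :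
    RationalCarrier C₉ → ∃ e₁ : ((𝓔 ⊔ 𝒦).comap τ ⊔ strictTransformIdeal τ (𝓔 ⊔ 𝒦) 𝒦).subscheme ≅ ProjCech.PP O 1,
      e₁.hom ≫ ProjCech.toSpec O 1 = ((𝓔 ⊔ 𝒦).comap τ ⊔ strictTransformIdeal τ (𝓔 ⊔ 𝒦) 𝒦).subschemeι ≫ τ ≫ f₀ := by
  obtain ⟨e', he'⟩ := coneRound_centreIso 𝓔 𝒦 hE𝒦 hτ
  exact hCrat_of_iso_over f₀ τ _ _ e' he' hCrat₀

end RatCarrier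

end Summit.ResolutionOfSingularities.ResolutionOfSingularities.Cruxes.EquisingularLiftNat.Sections

end
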